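import Literature.NumberTheory.EllipticCurves.Sprung2017.ChromaticLimit
import HarnessLib

/-!
# The chromatic (♯/♭) limit of an integral queue sequence EXISTS for `p ∣ a_p` (Sprung 2017 Cor. 4.4 /
# Thm. 1.12; Sprung 2012 Prop. 5.3, 5.7, Def. 5.9) — proof, and the limit as a function

Topic `Literature/NumberTheory/EllipticCurves`, cluster `Sprung2017`; companion of `ChromaticLimit.lean`
(definitions `IsQueueSequence`, `IsChromaticLimit`, uniqueness `IsChromaticLimit.unique`; see its module
docstring for the sources, the two printed instances — Mazur–Tate elements ↦ `(L♯, L♭)`, Kurihara–Kobayashi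
pairing values ↦ the Coleman maps `(Col♯, Col♭)` — and the purpose: unit U3 of
`run/shared/lean/pub/bsd-littype/staging/bsd-littype-11/SHARPFLAT-PROGRAMME.md`, cell `bsd-littype`,
seat `bsd-littype-11` g2). THIS FILE: the EXISTENCE half — `IsQueueSequence.exists_isChromaticLimit`, the
`θ`-free core of the tree's `exists_integral_isSprungPair_of_lifts` (`SharpFlatPAdicLFunctionProofs.lean`
§7, whose private helpers `pord_*` and the two coefficientwise-limit lemmas are COPIED here because they
are private there) — then `existsUnique_isChromaticLimit`, and the limit as a FUNCTION
`IsQueueSequence.lim` (`Classical.choose`; the shape in which Sprung 2012 Def. 5.9 / 7.1 define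
`(Col♯(z), Col♭(z))`) with `isChromaticLimit_lim`, `IsChromaticLimit.eq_lim`. Theorems + one definition;
no named fact, nothing asserted about any curve; axioms standard.

References: [Sprung2017] Def. 1.7, §4 Cor. 4.4, "Proposition (𝔐 = 0)", Thm. 1.12
[corpus: paper:arxiv-1601.00010 p0009, p0016–p0017]; [Sprung2012] Prop. 5.3, Cor. 5.6, Prop. 5.7,
Lemma 5.8, Def. 5.9, Def. 7.1 [corpus: paper:doi-10-1016-j-jnt-2011-11-003 p0011 L99 – p0013 L95,
p0018 L5]; S. Lang, *Cyclotomic Fields I–II*, Ch. 5 §1 Thm. 1.1.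
-/

set_option autoImplicit false

noncomputable section

open Polynomial Literature.NumberTheory.EllipticCurves

namespace Literature.NumberTheory.EllipticCurves.Sprung2017

variable {p : ℕ} [hp : Fact p.Prime]

/-! ### Private helpers (copies of the private helpers of `SharpFlatPAdicLFunctionProofs.lean` §6–§7) -/

section Helpers

/-- Order `≥ 0` is no condition. [folklore] -/
private theorem pord_zero (P : ℤ_[p][X]) (i : ℕ) : (p : ℤ_[p]) ^ (0 - i) ∣ P.coeff i := by
  rw [Nat.zero_sub, pow_zero]
  exact one_dvd _

/-- Orders add under multiplication. [folklore] -/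
private theorem pord_mul {K K' : ℕ} {P Q : ℤ_[p][X]} (hP : ∀ i, (p : ℤ_[p]) ^ (K - i) ∣ P.coeff i)
    (hQ : ∀ i, (p : ℤ_[p]) ^ (K' - i) ∣ Q.coeff i) (i : ℕ) :
    (p : ℤ_[p]) ^ (K + K' - i) ∣ (P * Q).coeff i := by
  rw [coeff_mul]
  refine Finset.dvd_sum fun x hx ↦ ?_
  obtain ⟨a, b⟩ := x
  have hab : a + b = i := Finset.HasAntidiagonal.mem_antidiagonal.mp hx
  calc (p : ℤ_[p]) ^ (K + K' - i) ∣ (p : ℤ_[p]) ^ (K - a) * (p : ℤ_[p]) ^ (K' - b) := by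
        rw [← pow_add]
        exact pow_dvd_pow _ (by omega)
    _ ∣ P.coeff a * Q.coeff b := mul_dvd_mul (hP a) (hQ b)

/-- Left multiplication by anything keeps the order. [folklore] -/
private theorem pord_mul_left {K : ℕ} {P : ℤ_[p][X]} (Q : ℤ_[p][X])
    (hP : ∀ i, (p : ℤ_[p]) ^ (K - i) ∣ P.coeff i) (i : ℕ) :
    (p : ℤ_[p]) ^ (K - i) ∣ (Q * P).coeff i := by
  have h := pord_mul (pord_zero Q) hP i
  rwa [zero_add] at h

/-- Orders are monotone. [folklore] -/
private theorem pord_mono {K K' : ℕ} (hK : K' ≤ K) {P : ℤ_[p][X]}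
    (hP : ∀ i, (p : ℤ_[p]) ^ (K - i) ∣ P.coeff i) (i : ℕ) :
    (p : ℤ_[p]) ^ (K' - i) ∣ P.coeff i :=
  (pow_dvd_pow _ (by omega)).trans (hP i)

open Filter _root_.Topology in
/-- Coefficientwise limits in `ℤ_p⟦T⟧` from `p`-adic divisibility of the steps (Lang, *Cyclotomic
Fields I–II*, Ch. 5 §1 Thm. 1.1, along half-integral exponents). [cite: Lang1990, Ch. 5 §1 Thm. 1.1] -/
private theorem exists_powerSeries_tendsto_coeff_of_dvd (P : ℕ → ℤ_[p][X]) (K₀ : ℕ)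
    (hP : ∀ M i, (p : ℤ_[p]) ^ (M / 2 - K₀ - i) ∣ (P (M + 1) - P M).coeff i) :
    ∃ L : PowerSeries ℤ_[p], ∀ i,
      Tendsto (fun M ↦ (P M).coeff i) atTop (𝓝 (PowerSeries.coeff i L)) := by
  have hstep : ∀ M k i, (p : ℤ_[p]) ^ (M / 2 - K₀ - i) ∣ (P (M + k) - P M).coeff i := by
    intro M k i
    induction k with
    | zero =>
      rw [add_zero, sub_self, coeff_zero]
      exact dvd_zero _
    | succ k ih =>
      have h1 : P (M + (k + 1)) - P M = (P (M + k + 1) - P (M + k)) + (P (M + k) - P M) := by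
        rw [← add_assoc]
        ring
      rw [h1, coeff_add]
      exact dvd_add ((pow_dvd_pow _ (by omega)).trans (hP (M + k) i)) ih
  have hnorm : ∀ M k i, ‖(P (M + k)).coeff i - (P M).coeff i‖ ≤
      (p : ℝ) ^ (-((M / 2 - K₀ - i : ℕ) : ℤ)) := by
    intro M k i
    rw [← coeff_sub]
    exact (PadicInt.norm_le_pow_iff_mem_span_pow _ _).mpr
      (Ideal.mem_span_singleton.mpr (hstep M k i))
  have hcau : ∀ i, CauchySeq (fun M ↦ (P M).coeff i) := fun i ↦ by
    refine Metric.cauchySeq_iff'.mpr fun ε hε ↦ ?_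
    obtain ⟨e, he⟩ := PadicInt.exists_pow_neg_lt p hε
    refine ⟨2 * (e + K₀ + i), fun n hn ↦ ?_⟩
    obtain ⟨k, rfl⟩ := Nat.exists_eq_add_of_le hn
    rw [dist_eq_norm]
    refine (hnorm _ k i).trans_lt ?_
    rwa [show 2 * (e + K₀ + i) / 2 - K₀ - i = e by omega]
  choose l hl using fun i ↦ cauchySeq_tendsto_of_complete (hcau i)
  exact ⟨PowerSeries.mk l, fun i ↦ by rw [PowerSeries.coeff_mk]; exact hl i⟩

open Filter _root_.Topology in
/-- Coefficientwise limits commute with multiplication by a fixed polynomial. [folklore] -/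
private theorem tendsto_coeff_mul (D : ℤ_[p][X]) {P : ℕ → ℤ_[p][X]} {L : PowerSeries ℤ_[p]}
    (h : ∀ j, Tendsto (fun M ↦ (P M).coeff j) atTop (𝓝 (PowerSeries.coeff j L))) (j : ℕ) :
    Tendsto (fun M ↦ (D * P M).coeff j) atTop
      (𝓝 (PowerSeries.coeff j ((D : PowerSeries ℤ_[p]) * L))) := by
  simp_rw [coeff_mul]
  rw [PowerSeries.coeff_mul]
  refine tendsto_finsetSum _ fun x _ ↦ ?_
  rw [Polynomial.coeff_coe]
  exact (h x.2).const_mul _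


end Helpers

/-! ### Existence of the chromatic limit (`p ∣ a_p`) -/

section Existence

open Filter _root_.Topology

/-- **Every integral queue sequence has a chromatic limit when `p ∣ a_p`** (Sprung 2017 Cor. 4.4 +
"Proposition (𝔐 = 0)" + proof of Thm. 1.12; Sprung 2012 Prop. 5.3 / 5.7 / Def. 5.9 for the pairing
sequences): there are `C♯, C♭ ∈ Λ` with `Θ_m + u_m C♯ + v_m C♭ ∈ ω_m Λ` for all `m`. Construction
(as in `exists_integral_isSprungPair_of_lifts`, of which this is the `θ`-free core): with the three-term
quotients `c_k`, the approximants `Y_n = (Θ_1, Θ_0) + T Σ_{k<n} c_k (v_{k+1}, −u_{k+1})` satisfy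
`Y_n·(u_{n+1}, v_{n+1}) = Θ_{n+1}`, `Y_n·(u_n, v_n) = Θ_n` EXACTLY (Wronskian
`u_{k+1}v_k − v_{k+1}u_k = ω_k/T`) and `Y_{m+M}·(u_m, v_m) = Θ_m − ω_m G_{m,M}`; `u_n, v_n ∈ (p,T)^{⌊n/2⌋}`
makes `Y_n`, `G_{m,·}` converge coefficientwise, and `(C♯, C♭) := −lim Y_n`.
[cite: Sprung2017, Cor. 4.4 and Thm. 1.12] [cite: Sprung2012, Prop. 5.7 and Def. 5.9] -/
theorem IsQueueSequence.exists_isChromaticLimit {ap : ℤ} (hpa : (p : ℤ) ∣ ap) {Θ : ℕ → ℤ_[p][X]}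
    (hΘ : IsQueueSequence p ap Θ) : ∃ Cs Cf : IwasawaAlgebra p, IsChromaticLimit p ap Θ Cs Cf := by
  classical
  choose c hc using hΘ
  -- the recursion polynomials and the cyclotomic data over `ℤ_p`
  set U : ℕ → ℤ_[p][X] := fun n ↦ (sharpPoly ap p n).map (Int.castRingHom ℤ_[p]) with hU
  set V : ℕ → ℤ_[p][X] := fun n ↦ (flatPoly ap p n).map (Int.castRingHom ℤ_[p]) with hV
  set Φ : ℕ → ℤ_[p][X] := fun k ↦
    ((cyclotomic (p ^ k) ℤ).comp (X + 1)).map (Int.castRingHom ℤ_[p]) with hΦ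
  set Ω : ℕ → ℤ_[p][X] := fun n ↦
    (∏ i ∈ Finset.range n, (cyclotomic (p ^ (i + 1)) ℤ).comp (X + 1)).map (Int.castRingHom ℤ_[p])
    with hΩ
  set ω : ℕ → ℤ_[p][X] := fun n ↦ (cyclotomicOmega p n).map (Int.castRingHom ℤ_[p]) with hω
  have hU0 : U 0 = 0 := by simp [hU]
  have hU1 : U 1 = 1 := by simp [hU]
  have hV0 : V 0 = 1 := by simp [hV]
  have hV1 : V 1 = 0 := by simp [hV]
  have hU2 : ∀ n, U (n + 2) = C (ap : ℤ_[p]) * U (n + 1) - Φ (n + 1) * U n := fun n ↦ by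
    simp only [hU, hΦ]
    rw [sharpPoly_add_two, Polynomial.map_sub, Polynomial.map_mul, Polynomial.map_mul,
      Polynomial.map_C, eq_intCast]
  have hV2 : ∀ n, V (n + 2) = C (ap : ℤ_[p]) * V (n + 1) - Φ (n + 1) * V n := fun n ↦ by
    simp only [hV, hΦ]
    rw [flatPoly_add_two, Polynomial.map_sub, Polynomial.map_mul, Polynomial.map_mul,
      Polynomial.map_C, eq_intCast]
  have hωΩ : ∀ n, ω n = X * Ω n := fun n ↦ by
    simp only [hω, hΩ]
    rw [← X_mul_prod_cyclotomic_comp_eq_cyclotomicOmega, Polynomial.map_mul, Polynomial.map_X]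
  have hΩs : ∀ n, Ω (n + 1) = Ω n * Φ (n + 1) := fun n ↦ by
    simp only [hΩ, hΦ]
    rw [Finset.prod_range_succ, Polynomial.map_mul]
  have hdet : ∀ n, U (n + 1) * V n - V (n + 1) * U n = Ω n := fun n ↦ by
    simp only [hU, hV, hΩ]
    rw [← Polynomial.map_mul, ← Polynomial.map_mul, ← Polynomial.map_sub,
      sharpPoly_succ_mul_flatPoly_sub]
  have hc' : ∀ n, Θ (n + 2) - C (ap : ℤ_[p]) * Θ (n + 1) + Φ (n + 1) * Θ n =
      X * Ω (n + 1) * c n := fun n ↦ by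
    rw [← hωΩ]
    exact hc n
  -- orders: `u_n, v_n ∈ (p, T)^{⌊n/2⌋}`
  have hUord : ∀ n i, (p : ℤ_[p]) ^ (n / 2 - i) ∣ (U n).coeff i := fun n i ↦
    pow_dvd_coeff_map_sprungSeq hpa 0 1 n i
  have hVord : ∀ n i, (p : ℤ_[p]) ^ (n / 2 - i) ∣ (V n).coeff i := fun n i ↦
    pow_dvd_coeff_map_sprungSeq hpa 1 0 n i
  -- the shifted Wronskians `V m * U (m + j) - U m * V (m + j) = Ω m * W m j`
  choose w hw hwo using fun m j ↦ exists_wronskian_eq_mul (p := p) hpa m j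
  set W : ℕ → ℕ → ℤ_[p][X] := fun m j ↦ (w m j).map (Int.castRingHom ℤ_[p]) with hW
  have hWr : ∀ m j, V m * U (m + j) - U m * V (m + j) = Ω m * W m j := fun m j ↦ by
    simp only [hU, hV, hΩ, hW]
    rw [← Polynomial.map_mul, ← Polynomial.map_mul, ← Polynomial.map_sub, hw,
      Polynomial.map_mul]
  -- the approximants `Y_n = (Θ_1, Θ_0) + T ∑_{k<n} c_k (v_{k+1}, -u_{k+1})`
  set Y₁ : ℕ → ℤ_[p][X] := fun n ↦ Θ 1 + X * ∑ k ∈ Finset.range n, c k * V (k + 1) with hY₁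
  set Y₂ : ℕ → ℤ_[p][X] := fun n ↦ Θ 0 - X * ∑ k ∈ Finset.range n, c k * U (k + 1) with hY₂
  have hY₁s : ∀ n, Y₁ (n + 1) = Y₁ n + X * (c n * V (n + 1)) := fun n ↦ by
    simp only [hY₁, Finset.sum_range_succ]
    ring
  have hY₂s : ∀ n, Y₂ (n + 1) = Y₂ n - X * (c n * U (n + 1)) := fun n ↦ by
    simp only [hY₂, Finset.sum_range_succ]
    ring
  -- Claim A: `Y_n · e_{n+1} = Θ_{n+1}` and `Y_n · e_n = Θ_n`, exactly
  have hA : ∀ n, U (n + 1) * Y₁ n + V (n + 1) * Y₂ n = Θ (n + 1) ∧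
      U n * Y₁ n + V n * Y₂ n = Θ n := by
    intro n
    induction n with
    | zero =>
      simp only [hY₁, hY₂, Finset.sum_range_zero, mul_zero, add_zero, sub_zero, hU0, hU1, hV0,
        hV1]
      constructor <;> ring
    | succ n ih =>
      obtain ⟨ih1, ih2⟩ := ih
      refine ⟨?_, ?_⟩
      · have h3 := hc' n
        rw [hΩs] at h3
        have hd := hdet n
        rw [show n + 1 + 1 = n + 2 by ring, hY₁s, hY₂s, hU2, hV2]
        linear_combination (C (ap : ℤ_[p])) * ih1 - Φ (n + 1) * ih2 +
          X * c n * Φ (n + 1) * hd - h3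
      · rw [hY₁s, hY₂s]
        linear_combination ih1
  -- Claim B: `Y_{m+M} · e_m = Θ_m - ω_m G_m(M)` with `G_m(M) = ∑_{k<M} c_{m+k} W_m(k+1)`
  set G : ℕ → ℕ → ℤ_[p][X] := fun m M ↦ ∑ k ∈ Finset.range M, c (m + k) * W m (k + 1) with hG
  have hGs : ∀ m M, G m (M + 1) = G m M + c (m + M) * W m (M + 1) := fun m M ↦ by
    simp only [hG, Finset.sum_range_succ]
  have hB : ∀ m M, U m * Y₁ (m + M) + V m * Y₂ (m + M) = Θ m - ω m * G m M := by
    intro m M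
    induction M with
    | zero =>
      simp only [hG, Finset.sum_range_zero, mul_zero, sub_zero, add_zero]
      exact (hA m).2
    | succ M ih =>
      have hWm := hWr m (M + 1)
      rw [show m + (M + 1) = m + M + 1 by ring, hY₁s, hY₂s, hGs, hωΩ]
      rw [show m + (M + 1) = m + M + 1 by ring] at hWm
      linear_combination ih - X * c (m + M) * hWm - G m M * hωΩ m
  -- convergence of `Y₁`, `Y₂` and of the `G_m`
  have hY₁c : ∀ M i, (p : ℤ_[p]) ^ (M / 2 - 0 - i) ∣ (Y₁ (M + 1) - Y₁ M).coeff i := by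
    intro M i
    rw [hY₁s, add_sub_cancel_left, Nat.sub_zero]
    exact pord_mono (by omega) (pord_mul_left X (pord_mul_left (c M) (hVord (M + 1)))) i
  have hY₂c : ∀ M i, (p : ℤ_[p]) ^ (M / 2 - 0 - i) ∣ (Y₂ (M + 1) - Y₂ M).coeff i := by
    intro M i
    rw [hY₂s, sub_sub_cancel_left, coeff_neg, dvd_neg, Nat.sub_zero]
    exact pord_mono (by omega) (pord_mul_left X (pord_mul_left (c M) (hUord (M + 1)))) i
  have hGc : ∀ m M i, (p : ℤ_[p]) ^ (M / 2 - 0 - i) ∣ (G m (M + 1) - G m M).coeff i := by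
    intro m M i
    rw [hGs, add_sub_cancel_left, Nat.sub_zero]
    exact pord_mono (by omega) (pord_mul_left (c (m + M)) (hwo m (M + 1))) i
  obtain ⟨y₁, hy₁⟩ := exists_powerSeries_tendsto_coeff_of_dvd Y₁ 0 hY₁c
  obtain ⟨y₂, hy₂⟩ := exists_powerSeries_tendsto_coeff_of_dvd Y₂ 0 hY₂c
  have hq : ∀ m, ∃ Q : PowerSeries ℤ_[p],
      (U m : PowerSeries ℤ_[p]) * y₁ + (V m : PowerSeries ℤ_[p]) * y₂ =
        (Θ m : PowerSeries ℤ_[p]) - (ω m : PowerSeries ℤ_[p]) * Q := by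
    intro m
    obtain ⟨Q, hQ⟩ := exists_powerSeries_tendsto_coeff_of_dvd (G m) 0 (hGc m)
    refine ⟨Q, PowerSeries.ext fun i ↦ ?_⟩
    have hshift : ∀ (Y : ℕ → ℤ_[p][X]) (y : PowerSeries ℤ_[p]),
        (∀ j, Tendsto (fun M ↦ (Y M).coeff j) atTop (𝓝 (PowerSeries.coeff j y))) →
        ∀ j, Tendsto (fun M ↦ (Y (m + M)).coeff j) atTop (𝓝 (PowerSeries.coeff j y)) := by
      intro Y y hY j
      have h3 : (fun M ↦ (Y (m + M)).coeff j) = fun M ↦ (fun n ↦ (Y n).coeff j) (M + m) := by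
        ext M
        rw [add_comm]
      rw [h3]
      exact (tendsto_add_atTop_iff_nat m).mpr (hY j)
    have h1 : Tendsto (fun M ↦ (U m * Y₁ (m + M) + V m * Y₂ (m + M)).coeff i) atTop
        (𝓝 (PowerSeries.coeff i ((U m : PowerSeries ℤ_[p]) * y₁ + (V m : PowerSeries ℤ_[p]) * y₂))) := by
      simp_rw [coeff_add]
      rw [map_add]
      exact (tendsto_coeff_mul (U m) (hshift Y₁ y₁ hy₁) i).add
        (tendsto_coeff_mul (V m) (hshift Y₂ y₂ hy₂) i)
    have h2 : Tendsto (fun M ↦ (U m * Y₁ (m + M) + V m * Y₂ (m + M)).coeff i) atTop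
        (𝓝 (PowerSeries.coeff i ((Θ m : PowerSeries ℤ_[p]) - (ω m : PowerSeries ℤ_[p]) * Q))) := by
      simp_rw [hB, coeff_sub]
      rw [map_sub, Polynomial.coeff_coe]
      exact tendsto_const_nhds.sub (tendsto_coeff_mul (ω m) hQ i)
    exact tendsto_nhds_unique h1 h2
  -- `(C♯, C♭) = -lim Y`
  refine ⟨-y₁, -y₂, fun m ↦ ?_⟩
  obtain ⟨Q, hQm⟩ := hq m
  refine ⟨Q, ?_⟩
  have htoI : ∀ q : ℤ[X], toIwasawa p q =
      ((q.map (Int.castRingHom ℤ_[p]) : ℤ_[p][X]) : PowerSeries ℤ_[p]) := fun q ↦ rfl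
  rw [htoI, htoI]
  change (Θ m : PowerSeries ℤ_[p]) + ((U m : PowerSeries ℤ_[p]) * -y₁ +
    (V m : PowerSeries ℤ_[p]) * -y₂) = (ω m : PowerSeries ℤ_[p]) * Q
  linear_combination (-1 : PowerSeries ℤ_[p]) * hQm

end Existence

/-! ### Exactly one limit; the limit as a function -/

section Limit

/-- **Exactly one chromatic limit** for an integral queue sequence with `p ∣ a_p`
(Sprung 2012 Prop. 5.3 + Prop. 5.7 / Def. 5.9; Sprung 2017 Thm. 1.12).
[cite: Sprung2012, Prop. 5.3, Prop. 5.7 and Def. 5.9] [cite: Sprung2017, Thm. 1.12] -/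
theorem IsQueueSequence.existsUnique_isChromaticLimit {ap : ℤ} (hpa : (p : ℤ) ∣ ap)
    {Θ : ℕ → ℤ_[p][X]} (hΘ : IsQueueSequence p ap Θ) :
    ∃! CC : IwasawaAlgebra p × IwasawaAlgebra p, IsChromaticLimit p ap Θ CC.1 CC.2 := by
  obtain ⟨Cs, Cf, h⟩ := hΘ.exists_isChromaticLimit hpa
  refine ⟨(Cs, Cf), h, fun CC hCC ↦ ?_⟩
  obtain ⟨h1, h2⟩ := hCC.unique hpa h
  exact Prod.ext h1 h2

/-- **The chromatic limit as a function** (the shape in which Sprung 2012 Def. 5.9 / 7.1 DEFINE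
`(Col♯(z), Col♭(z))` from the pairing sequence of `z`): the unique pair of
`existsUnique_isChromaticLimit`, chosen. [cite: Sprung2012, Def. 5.9 and Def. 7.1] -/
def IsQueueSequence.lim {ap : ℤ} (hpa : (p : ℤ) ∣ ap) {Θ : ℕ → ℤ_[p][X]}
    (hΘ : IsQueueSequence p ap Θ) : IwasawaAlgebra p × IwasawaAlgebra p :=
  Classical.choose (hΘ.existsUnique_isChromaticLimit hpa).exists

/-- The chosen pair IS a chromatic limit. [cite: Sprung2012, Prop. 5.7 and Def. 5.9] -/
theorem IsQueueSequence.isChromaticLimit_lim {ap : ℤ} (hpa : (p : ℤ) ∣ ap) {Θ : ℕ → ℤ_[p][X]}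
    (hΘ : IsQueueSequence p ap Θ) : IsChromaticLimit p ap Θ (hΘ.lim hpa).1 (hΘ.lim hpa).2 :=
  Classical.choose_spec (hΘ.existsUnique_isChromaticLimit hpa).exists

/-- Any chromatic limit equals the chosen one. [cite: Sprung2012, Prop. 5.3 (uniqueness)] -/
theorem IsChromaticLimit.eq_lim {ap : ℤ} (hpa : (p : ℤ) ∣ ap) {Θ : ℕ → ℤ_[p][X]}
    (hΘ : IsQueueSequence p ap Θ) {Cs Cf : IwasawaAlgebra p} (h : IsChromaticLimit p ap Θ Cs Cf) :
    (Cs, Cf) = hΘ.lim hpa := by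
  obtain ⟨h1, h2⟩ := h.unique hpa (hΘ.isChromaticLimit_lim hpa)
  exact Prod.ext h1 h2


end Limit

end Literature.NumberTheory.EllipticCurves.Sprung2017

end
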